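import Summits.AtomisticToContinuum.HydrodynamicLimit.Theses.LindebergRandomFuture
import Summits.AtomisticToContinuum.HydrodynamicLimit.Theorems.LambertianContactSwapLambertianEulerOfHearts
import Summits.AtomisticToContinuum.HydrodynamicLimit.Theses.LambertianContactSwap
import Summits.AtomisticToContinuum.HydrodynamicLimit.Theorems.LambertianContactSwapLambertianEulerArchimedes
import Summits.AtomisticToContinuum.HydrodynamicLimit.Theorems.LambertianContactSwapLambertianEulerLambertLaw
import Summits.AtomisticToContinuum.HydrodynamicLimit.Theorems.LambertianContactSwapLambertianEulerPovzner
import Summits.AtomisticToContinuum.HydrodynamicLimit.Theorems.LambertianContactSwapLambertianEulerPairPovzner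
import Summits.AtomisticToContinuum.HydrodynamicLimit.Theorems.LambertianContactSwapLambertianEulerContactIsotropy
import Summits.AtomisticToContinuum.HydrodynamicLimit.Theorems.LambertianContactSwapLambertianEulerMomentLedgerChain
import Summits.AtomisticToContinuum.HydrodynamicLimit.Theorems.LambertianContactSwapLambertianEulerGibbsInvariance
import Summits.AtomisticToContinuum.HydrodynamicLimit.Theorems.LambertianContactSwapLambertianEulerEntropyToHydro
import Summits.AtomisticToContinuum.HydrodynamicLimit.Theorems.LambertianContactSwapLambertianEulerWindow
import Summits.AtomisticToContinuum.HydrodynamicLimit.Theorems.LambertianContactSwapLambertianEulerMarkov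
import Summits.AtomisticToContinuum.HydrodynamicLimit.Theorems.LambertianContactSwapLambertianEulerIterate
import Summits.AtomisticToContinuum.HydrodynamicLimit.Theorems.LambertianContactSwapLambertianEulerDock
import Summits.AtomisticToContinuum.HydrodynamicLimit.Theorems.LambertianContactSwapLambertianEulerKlLedger
import Summits.AtomisticToContinuum.HydrodynamicLimit.Theorems.LambertianContactSwapLambertianEulerLawSemigroup
import Summits.AtomisticToContinuum.HydrodynamicLimit.Theorems.LambertianContactSwapLambertianEulerDockRf
import Summits.AtomisticToContinuum.HydrodynamicLimit.Theorems.LambertianContactSwapLambertianEulerLambertDirMean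
import Summits.AtomisticToContinuum.HydrodynamicLimit.Theorems.LambertianContactSwapLambertianEulerPairMeanSq
import Summits.AtomisticToContinuum.HydrodynamicLimit.Theorems.LambertianContactSwapLambertianEulerPathwiseProduction
import Summits.AtomisticToContinuum.HydrodynamicLimit.Theorems.LambertianContactSwapLambertianEulerWindowLedger
import Summits.AtomisticToContinuum.HydrodynamicLimit.Theorems.LambertianContactSwapLambertianEulerCollisionCompensator
import Summits.AtomisticToContinuum.HydrodynamicLimit.Theorems.LambertianContactSwapLambertianEulerCompensatedJump
import Summits.AtomisticToContinuum.HydrodynamicLimit.Theorems.LambertianContactSwapLambertianEulerAprioriEntropyBound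
import Summits.AtomisticToContinuum.HydrodynamicLimit.Theorems.LambertianContactSwapLambertianEulerCollisionIntensity
import Summits.AtomisticToContinuum.HydrodynamicLimit.Theorems.LambertianContactSwapLambertianEulerTwoTimeLaw
import Summits.AtomisticToContinuum.HydrodynamicLimit.Theorems.LambertianContactSwapLambertianEulerCollisionBudget
import Summits.AtomisticToContinuum.HydrodynamicLimit.Theorems.LambertianContactSwapLambertianEulerExpectedWindowProductionTools
import Summits.AtomisticToContinuum.HydrodynamicLimit.Theorems.LambertianContactSwapLambertianEulerExpectedWindowProduction
import Summits.AtomisticToContinuum.HydrodynamicLimit.Theorems.LambertianContactSwapLambertianEulerProductionSplit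
import Summits.AtomisticToContinuum.HydrodynamicLimit.Theorems.TwoClocksClampedEntropyClockTimeZeroReference
import Summits.AtomisticToContinuum.HydrodynamicLimit.Theorems.TwoClocksClampedEntropyClockDiscreteEntropyGronwall
import Summits.AtomisticToContinuum.HydrodynamicLimit.Theorems.TwoClocksClampedEntropyClockKlDivLawAtLocalGibbsNeTop
import Literature.MathematicalPhysics.KineticTheory.LambertianRedrawNondegenerate
import Literature.MathematicalPhysics.KineticTheory.Hilbert6Wave0Proofs
import Literature.MathematicalPhysics.KineticTheory.HardSphereEulerLLN
import Literature.MathematicalPhysics.KineticTheory.HardSphereEulerDim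
import Literature.Barriers.AtomisticToContinuum.HighMomentumCutoff
import Literature.Analysis.FluidPDE.HardSphereAlexander
import HarnessLib

/-! TTRL-lite variant V4541 of stmt-AtomisticToContinuum-11854 -/

/-!
Variant V4541 = `stub_diluteSelfConsistency` with hypothesis 4 (`∀ x, 0 < a₀ x`) DROPPED. It is FALSE:
with the zero activity profile `a₀ ≡ 0` the local Gibbs profile, hence its tensor power, hence the
canonical density vanish, so `localGibbsLaw σ 0 u₀ θ₀ N Φ = 0` is the zero measure and the `t = 0`
tie `TendstoHydroFieldsAt … 0` holds for EVERY `(ρ, u, θ)`; the constant state `ρ ≡ σ⁻³, u ≡ 0, θ ≡ 1`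
is a classical hard-sphere Euler solution (all derivatives vanish) with packing `ρ σ³ = 1 = η`.
Flows exist for `σ < 1/2` (Alexander). So the dropped positivity of `a₀` is load-bearing.
-/

noncomputable section

namespace Summit.AtomisticToContinuum.HydrodynamicLimit.Theorems

open scoped BigOperators Topology ENNReal InnerProductSpace
open MeasureTheory ProbabilityTheory Filter Set InformationTheory
open Literature.MathematicalPhysics.KineticTheory
open Literature.Analysis.FluidPDE Literature.Analysis.FluidPDE.Alexander
open Summit.AtomisticToContinuum.HydrodynamicLimit.Theses.LambertianContactSwap
open Summit.AtomisticToContinuum.HydrodynamicLimit.Theorems.ClampedCurrentsDockPathwise (gSum DgSum)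

/-- With the zero activity profile the local Gibbs law is the zero measure (the one-particle profile,
its tensor power and the canonical density all vanish identically). [folklore] -/
theorem localGibbsLaw_activity_zero_var4541 (σ : ℝ) (u₀ : T3 → V3) (θ₀ : T3 → ℝ) (N : ℕ)
    (Φ : HardSphereFlow (Torus.geometry (Fin 3)) (hsDiameter σ N) (N + 1)) :
    localGibbsLaw σ (fun _ => 0) u₀ θ₀ N Φ = 0 := by
  have hprof : localGibbsProfile (fun _ => (0 : ℝ)) u₀ θ₀ = 0 := by
    funext y
    simp [localGibbsProfile]
  have hdens : canonicalDensity (Torus.geometry (Fin 3)) (hsDiameter σ N) (N + 1)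
      (localGibbsProfile (fun _ => (0 : ℝ)) u₀ θ₀) = 0 := by
    funext z
    have htp : tensorPow (N + 1) (0 : T3 × V3 → ℝ) = 0 := by
      funext Z
      simp [tensorPow]
    rw [hprof, canonicalDensity, htp]
    simp
  rw [localGibbsLaw, particleLaw_eq, hdens]
  simp

/-- TTRL-lite variant V4541 of `stub_diluteSelfConsistency` (drop `∀ x, 0 < a₀ x`) is FALSE: witness
`η = 1`, `a₀ ≡ 0`, `θ₀ ≡ 1`, `u₀ ≡ 0`; for any `σ₀` take `σ = min (σ₀/2) (1/4)`, the constant Euler state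
`(σ⁻³, 0, 1)` on `[0, 1)`, Alexander flows, and the vacuous tie under the zero law. [folklore] -/
theorem stub_diluteSelfConsistency_var4541_false : ¬ (∀ η : ℝ, 0 < η → ∀ (a₀ θ₀ : T3 → ℝ) (u₀ : T3 → V3), Continuous a₀ → Continuous θ₀ → Continuous u₀ → (∀ x, 0 < θ₀ x) → ∃ σ₀ : ℝ, 0 < σ₀ ∧ ∀ σ : ℝ, 0 < σ → σ < σ₀ → ∀ (T : ℝ) (ρ θ : ℝ → T3 → ℝ) (u : ℝ → T3 → V3), IsHardSphereEulerSolution σ T ρ u θ → ∀ Φ : (N : ℕ) → HardSphereFlow (Torus.geometry (Fin 3)) (hsDiameter σ N) (N + 1), TendstoHydroFieldsAt (fun N => localGibbsLaw σ a₀ u₀ θ₀ N (Φ N)) Φ ρ u θ 0 → ∀ t ∈ Set.Ico 0 T, ∀ x, ρ t x * σ ^ 3 < η) := by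
  intro h
  obtain ⟨σ₀, hσ₀, H⟩ := h 1 one_pos (fun _ => 0) (fun _ => 1) (fun _ => 0) continuous_const
    continuous_const continuous_const (fun _ => one_pos)
  set σ : ℝ := min (σ₀ / 2) (1 / 4) with hσdef
  have hσ : 0 < σ := lt_min (by positivity) (by norm_num)
  have hσlt : σ < σ₀ := (min_le_left _ _).trans_lt (by linarith)
  have hσ2 : σ < 1 / 2 := (min_le_right _ _).trans_lt (by norm_num)
  -- Alexander flows at every particle number (`hsDiameter σ N ≤ σ < 1/2`).
  let Φ : (N : ℕ) → HardSphereFlow (Torus.geometry (Fin 3)) (hsDiameter σ N) (N + 1) := fun N =>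
    Classical.choice (HardSphereFlow.nonempty_torus_holds (d := Fin 3) (hsDiameter_pos hσ N)
      ((hsDiameter_le hσ.le N).trans_lt (hσ2.trans_eq (by norm_num))) (N + 1))
  -- The constant state of density `σ⁻³` is a classical hard-sphere Euler solution on `[0, 1)`.
  have hE : IsHardSphereEulerSolution σ 1 (fun _ _ => (σ ^ 3)⁻¹) (fun _ _ => (0 : V3)) (fun _ _ => 1) :=
    isHardSphereEulerSolutionDim_three_iff.1
      (IsHardSphereEulerSolutionDim.const σ 1 (0 : V3) (inv_pos.2 (pow_pos hσ 3)) one_pos)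
  -- Under the zero law the `t = 0` tie is vacuous.
  have htie : TendstoHydroFieldsAt (fun N => localGibbsLaw σ (fun _ => 0) (fun _ => 0) (fun _ => 1) N (Φ N)) Φ
      (fun _ _ => (σ ^ 3)⁻¹) (fun _ _ => (0 : V3)) (fun _ _ => 1) 0 := by
    intro χ _ δ _
    simp only [localGibbsLaw_activity_zero_var4541, Measure.coe_zero, Pi.zero_apply]
    exact ⟨tendsto_const_nhds, tendsto_const_nhds, tendsto_const_nhds⟩
  have hlt := H σ hσ hσlt 1 (fun _ _ => (σ ^ 3)⁻¹) (fun _ _ => 1) (fun _ _ => (0 : V3)) hE Φ htie 0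
    ⟨le_rfl, one_pos⟩ 0
  rw [inv_mul_cancel₀ (pow_pos hσ 3).ne'] at hlt
  exact lt_irrefl _ hlt

end Summit.AtomisticToContinuum.HydrodynamicLimit.Theorems

end
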